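import Literature.AlgebraicGeometry.GroupSchemes.AdmissibleIdealTransport          -- ★ `comap_appTop_ker_kerι_relFrobeniusOver`, `etale_specOver_quotient_comap_appTop_iff`, `finrank_quotient_comap_appTop`, `comap_appTop_comp` ∕ `_id`
import Literature.AlgebraicGeometry.GroupSchemes.EtaleIdealEqPointsIdeal            -- ★ `EtaleIdealPoints.eq_of_etale_of_finrank_eq_natCard_sections` (UNIQUENESS of the étale member)
import Literature.AlgebraicGeometry.GroupSchemes.FrobeniusKillsQuotientEtale        -- ★ `FrobKillEt.finrank_quotient_le_natCard_hom` (`dim Γ(G)⧸I ≤ #G(k)` for étale `V(I)`)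
import HarnessLib

/-!
# Admissible transport is CANONICAL: two isomorphisms of `w`-blocks carry an admissible ideal to the SAME ideal
# (so every equivariant automorphism fixes every admissible ideal, and transports along a chain of isomorphisms are cocycle-free)

Topic `Literature/AlgebraicGeometry/GroupSchemes`; namespace `Literature.AlgebraicGeometry.GroupSchemes.AdmIdealTransport` (continues ★
`AdmissibleIdealTransport` — transport `I ↦ Γ(φ)⁻¹ I` of Hopf ideals along an isomorphism `φ : G ⥲ G'`, preserving order, étaleness and the
Frobenius kernel —, ★ `EtaleIdealEqPointsIdeal` — an étale closed subscheme of degree `#G(k)` is UNIQUE — and ★ `FrobeniusKillsQuotientEtale` §1 —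
`dim_k Γ(G)⧸I ≤ #G(k)` for étale `V(I)`).  THEOREMS ONLY (no definition, no instance, no notation, no named fact, no `sorry`).  Cell `hodgecm-mathlib`
(D-0151), programme P6 «MOD», line L2 of the D-line socket `stub_DOWN` (`Cruxes/HLiu418/Lines/F0_P6a_DatumOfInputs.lean` ED. 1 :515), generic sub-organ
**(T-can) «ADMISSIBLE TRANSPORT IS CANONICAL»** of organ (O3) `stub_TRANSPORT` (LA2-plan (g0) deal 2026-09-02T02:06Z; payer LA2-p01 (g0)): the transport organ
moves the `e`-sheet readings `quot ∕ isogW₀ ∕ smap` along layer isomorphisms `(𝔡 x̄).G₀ ≅ (𝔡 (θ(τ,1)_s x̄)).G₀` that are only EXISTENTIAL (organ `stub_LAYERISO`),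
hence chosen independently at every `(τ, x̄)` with no cocycle; this file is the pin that makes every such choice IRRELEVANT on the admissible carriers
`SubOf = AdmSub`: the transported ideal depends only on source and target, never on the isomorphism.  Count-neutral Mathlib-side capital: HC_CM is proved
only modulo the 7 printed citations (2 remaining named inputs hLiu418 24832, h413 24833) until rung 0 closes; nothing here bears on it.

THE PRINT.  [Tate1997FiniteFlatGroupSchemes] (3.7): over `k = k̄` a finite commutative group scheme `G` has the canonical connected–étale sequence
`0 → G⁰ → G → G^{ét} → 0`, `#G(k) · rk G⁰ = rk G`, and `G_red ⊆ G` is THE étale closed subgroup carrying all of `G(k)`; [SGA3I] VII_A 4.1: the relative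
Frobenius `F^{(f)}_{G∕k}` is functorial in homomorphisms, so `Ker F^{(f)}` is carried to `Ker F^{(f)}` by every isomorphism.  On a `w`-BLOCK (the
`𝔭_{c•w}`-torsion layer `G = A_x̄[𝔭]` of the P6 dock: rank `q²`, `q = p^f`, `#G(k) ∈ {1, q}`) the ADMISSIBLE ideals (Hopf, corank `q`, `𝒪_F`-stable) are,
by the ★ dichotomy `eq_kerFI_or_idealIsEtale_of_isAdm` ([HarrisTaylorAMS2001] Lemma II.2.1 flavour), the Frobenius-kernel ideal `ker Γ(ι_{Ker F^{(f)}})`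
or ÉTALE of corank `q`; an étale one has `q` rational points inside `G(k)`, so `#G(k) = q` (or `q = 1`) and it is the unique étale closed subscheme of
degree `#G(k)` ([StacksProject] 00U3 ∕ ★ `eq_of_etale_of_finrank_eq_natCard_sections`).  Both kinds are therefore CANONICAL, and any two isomorphisms
`φ, ψ : G ⥲ G'` of group schemes give `Γ(φ)⁻¹ I = Γ(ψ)⁻¹ I`.

DATA.  `k` algebraically closed of exponential characteristic `p`, `f : ℕ` (`q = p ^ f`); `G G' G''` affine group objects of `SchemeOver k`; isomorphisms
`φ ψ : G ≅ G'` with `φ.hom`, `ψ.hom` homomorphisms (`IsMonHom`); an ideal `I ⊆ Γ(G)` of corank `q` satisfying the DICHOTOMY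
`I = ker Γ(ι_{Ker F^{(f)}_G}) ∨ Etale (Spec (Γ(G) ⧸ I) → Spec k)` (the ★ D-line predicates `kerFI` ∕ `IdealIsEtale` UNFOLDED — this file is generic and
cannot import the Cruxes vocabulary); the point count `#(𝟙 ⟶ G') ∈ {1, q}` of the TARGET (the dock row `hpts₀`).
* §1 `finrank_quotient_eq_natCard_sections_of_etale` — an étale ideal of corank `q` in a finite `G'` with `#G'(k) ∈ {1, q}` has corank EXACTLY `#G'(k)`
  (if `#G'(k) = 1` then `q ≤ 1`, and `q = p^f ≥ 1`).
* §2 `dichotomy_comap_appTop` — the dichotomy transports: `Γ(φ)⁻¹ I` is `ker Γ(ι_{Ker F^{(f)}_{G'}})` or étale (★ §5–§6 of `AdmissibleIdealTransport`).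
* §3 HEAD **`comap_appTop_eq_comap_appTop_of_dichotomy` — `Γ(φ)⁻¹ I = Γ(ψ)⁻¹ I`** for any two isomorphisms of group schemes `φ ψ : G ⥲ G'`;
  **`comap_appTop_eq_self_of_dichotomy`** — an automorphism `α : G ⥲ G` FIXES `I`; `comap_appTop_inv_eq_comap_appTop_of_dichotomy` (along `φ⁻¹` from `G'`
  back = along any `χ : G' ⥲ G`).
* §4 COCYCLE-FREENESS **`comap_appTop_comap_appTop_eq_of_dichotomy`** — `Γ(χ)⁻¹ (Γ(φ)⁻¹ I) = Γ(ω)⁻¹ I` for `φ : G ⥲ G'`, `χ : G' ⥲ G''` and ANY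
  `ω : G ⥲ G''` (★ functoriality `comap_appTop_comp` + §3 at `φ ≪≫ χ` vs `ω`), and the round trip `Γ(χ)⁻¹ (Γ(φ)⁻¹ I) = I` for `χ : G' ⥲ G`.
No stability ∕ equivariance hypothesis is needed for canonicity (it is needed only to know that the transported ideal is again ADMISSIBLE, ★
`isHopfIdeal_and_finrank_and_map_le_comap_appTop`).

## References
* [Tate1997FiniteFlatGroupSchemes] J. Tate, *Finite flat group schemes*, in: Modular Forms and Fermat's Last Theorem (1997) — (3.7).
* [SGA3I] M. Demazure, A. Grothendieck (eds.), *SGA 3, Tome I*, Exp. VII_A §4, 4.1 (relative Frobenius; functoriality).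
* [StacksProject] The Stacks Project, Tag 00U3 (étale algebras over separably closed fields split).
* [HarrisTaylorAMS2001] M. Harris, R. Taylor, *The geometry and cohomology of some simple Shimura varieties* (2001) — Lemma II.2.1.
-/

set_option autoImplicit false

-- Mathlib's `Over`/`Scheme` APIs and the transported group structure on the Frobenius twist are stated across semireducible wrappers
-- (as in ★ `GroupSchemes/*`).
set_option backward.isDefEq.respectTransparency false

noncomputable section

open CategoryTheory CategoryTheory.Limits AlgebraicGeometry MonoidalCategory CartesianMonoidalCategory

open scoped MonObj Obj

universe u

namespace Literature.AlgebraicGeometry.GroupSchemes.AdmIdealTransport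

open Literature.AlgebraicGeometry.Motives AffineGroupScheme
open GroupSchemeKernel (kerι)

variable {k : Type u} [Field k] [IsAlgClosed k] (p : ℕ) [ExpChar k p] (f : ℕ)

/-! ## §1 An étale ideal of corank `q` in a block with `#G(k) ∈ {1, q}` has corank `#G(k)` -/

section Count

variable (G' : SchemeOver k) [IsAffine G'.left] [IsFinite G'.hom]

omit [ExpChar k p] in
/-- **An étale ideal of corank `q = p^f` in a finite `k`-scheme `G'` with `#G'(k) ∈ {1, q}` has corank `#G'(k)`**: its `q` rational points lie in
`G'(k)` (★ `FrobKillEt.finrank_quotient_le_natCard_hom`), so `#G'(k) = 1` forces `q ≤ 1 ≤ q`. [cite: Tate1997FiniteFlatGroupSchemes, (3.7)]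
[cite: StacksProject, Tag 00U3] -/
theorem finrank_quotient_eq_natCard_sections_of_etale (hp : 0 < p) (I' : Ideal (Alg G'))
    (hIet : Etale (Motives.specOver k (Alg G' ⧸ I')).hom) (hI' : Module.finrank k (Alg G' ⧸ I') = p ^ f)
    (hpts : Nat.card (𝟙_ (SchemeOver k) ⟶ G') = 1 ∨ Nat.card (𝟙_ (SchemeOver k) ⟶ G') = p ^ f) :
    Module.finrank k (Alg G' ⧸ I') = Nat.card (𝟙_ (SchemeOver k) ⟶ G') := by
  rcases hpts with h1 | hq
  · haveI : Finite (𝟙_ (SchemeOver k) ⟶ G') := Nat.finite_of_card_ne_zero (by rw [h1]; exact one_ne_zero)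
    have hle : Module.finrank k (Alg G' ⧸ I') ≤ Nat.card (𝟙_ (SchemeOver k) ⟶ G') :=
      FrobKillEt.finrank_quotient_le_natCard_hom G' I' hIet
    have hpos : 0 < Module.finrank k (Alg G' ⧸ I') := by
      rw [hI']
      exact Nat.pow_pos hp
    omega
  · exact hI'.trans hq.symm

end Count

/-! ## §2 The dichotomy «Frobenius kernel or étale» transports along an isomorphism -/

section Transport

variable {G G' G'' : SchemeOver k} [GrpObj G] [GrpObj G'] [GrpObj G'']

omit [IsAlgClosed k] in
/-- **THE DICHOTOMY TRANSPORTS**: if `I` is the Frobenius-kernel ideal of `G` or étale, then `Γ(φ)⁻¹ I` is the Frobenius-kernel ideal of `G'` or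
étale (★ `comap_appTop_ker_kerι_relFrobeniusOver`, ★ `etale_specOver_quotient_comap_appTop_iff`). [cite: SGA3I, VII_A 4.1]
[cite: Tate1997FiniteFlatGroupSchemes, (3.7)] -/
theorem dichotomy_comap_appTop (φ : G ≅ G') [IsMonHom φ.hom] (I : Ideal (Alg G))
    (hdich : I = (RingHom.ker (kerι (relFrobeniusOver p f G)).left.appTop.hom : Ideal (Alg G)) ∨
      Etale (Motives.specOver k (Alg G ⧸ I)).hom) :
    (I.comap φ.hom.left.appTop.hom : Ideal (Alg G')) = (RingHom.ker (kerι (relFrobeniusOver p f G')).left.appTop.hom : Ideal (Alg G')) ∨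
      Etale (Motives.specOver k (Alg G' ⧸ (I.comap φ.hom.left.appTop.hom : Ideal (Alg G')))).hom := by
  rcases hdich with rfl | het
  · exact Or.inl (comap_appTop_ker_kerι_relFrobeniusOver p f φ)
  · exact Or.inr ((etale_specOver_quotient_comap_appTop_iff φ I).mpr het)

/-! ## §3 HEAD: two isomorphisms transport an admissible ideal to the same ideal -/

/-- **HEAD — ADMISSIBLE TRANSPORT IS CANONICAL: `Γ(φ)⁻¹ I = Γ(ψ)⁻¹ I`** for any two isomorphisms of group schemes `φ ψ : G ⥲ G'` over `k = k̄` and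
an ideal `I ⊆ Γ(G)` of corank `q = p^f` which is the Frobenius-kernel ideal or étale, the target having `#G'(k) ∈ {1, q}`.  Frobenius branch: both
sides are `ker Γ(ι_{Ker F^{(f)}_{G'}})` ([SGA3I] VII_A 4.1, ★ `comap_appTop_ker_kerι_relFrobeniusOver`).  Étale branch: both sides are étale of corank
`q = #G'(k)` (§1), hence equal by the uniqueness of the étale closed subscheme of full degree (★ `EtaleIdealPoints.eq_of_etale_of_finrank_eq_natCard_sections`).
[cite: Tate1997FiniteFlatGroupSchemes, (3.7)] [cite: SGA3I, VII_A 4.1] [cite: StacksProject, Tag 00U3] -/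
theorem comap_appTop_eq_comap_appTop_of_dichotomy [IsAffine G'.left] [IsFinite G'.hom] (φ ψ : G ≅ G') [IsMonHom φ.hom] [IsMonHom ψ.hom]
    (I : Ideal (Alg G))
    (hdich : I = (RingHom.ker (kerι (relFrobeniusOver p f G)).left.appTop.hom : Ideal (Alg G)) ∨
      Etale (Motives.specOver k (Alg G ⧸ I)).hom)
    (hI : Module.finrank k (Alg G ⧸ I) = p ^ f)
    (hpts' : Nat.card (𝟙_ (SchemeOver k) ⟶ G') = 1 ∨ Nat.card (𝟙_ (SchemeOver k) ⟶ G') = p ^ f) :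
    (I.comap φ.hom.left.appTop.hom : Ideal (Alg G')) = I.comap ψ.hom.left.appTop.hom := by
  rcases hdich with rfl | het
  · rw [comap_appTop_ker_kerι_relFrobeniusOver p f φ, comap_appTop_ker_kerι_relFrobeniusOver p f ψ]
  · have hp : 0 < p := expChar_pos k p
    have e₁ := (etale_specOver_quotient_comap_appTop_iff φ I).mpr het
    have e₂ := (etale_specOver_quotient_comap_appTop_iff ψ I).mpr het
    have r₁ : Module.finrank k (Alg G' ⧸ (I.comap φ.hom.left.appTop.hom : Ideal (Alg G'))) = p ^ f :=
      (finrank_quotient_comap_appTop φ I).trans hI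
    have r₂ : Module.finrank k (Alg G' ⧸ (I.comap ψ.hom.left.appTop.hom : Ideal (Alg G'))) = p ^ f :=
      (finrank_quotient_comap_appTop ψ I).trans hI
    exact EtaleIdealPoints.eq_of_etale_of_finrank_eq_natCard_sections G' _ _ e₁ e₂
      (finrank_quotient_eq_natCard_sections_of_etale p f G' hp _ e₁ r₁ hpts')
      (finrank_quotient_eq_natCard_sections_of_etale p f G' hp _ e₂ r₂ hpts')

/-- **AN AUTOMORPHISM OF GROUP SCHEMES FIXES EVERY ADMISSIBLE IDEAL: `Γ(α)⁻¹ I = I`** (`α : G ⥲ G` with `α.hom` a homomorphism; `I` the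
Frobenius-kernel ideal or étale, of corank `q`, `#G(k) ∈ {1, q}`) — the HEAD at `ψ := 𝟙`. [cite: Tate1997FiniteFlatGroupSchemes, (3.7)] [cite: SGA3I, VII_A 4.1] -/
theorem comap_appTop_eq_self_of_dichotomy [IsAffine G.left] [IsFinite G.hom] (α : G ≅ G) [IsMonHom α.hom] (I : Ideal (Alg G))
    (hdich : I = (RingHom.ker (kerι (relFrobeniusOver p f G)).left.appTop.hom : Ideal (Alg G)) ∨
      Etale (Motives.specOver k (Alg G ⧸ I)).hom)
    (hI : Module.finrank k (Alg G ⧸ I) = p ^ f)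
    (hpts : Nat.card (𝟙_ (SchemeOver k) ⟶ G) = 1 ∨ Nat.card (𝟙_ (SchemeOver k) ⟶ G) = p ^ f) :
    (I.comap α.hom.left.appTop.hom : Ideal (Alg G)) = I := by
  haveI : IsMonHom (Iso.refl G).hom := inferInstanceAs (IsMonHom (𝟙 G))
  rw [comap_appTop_eq_comap_appTop_of_dichotomy p f α (Iso.refl G) I hdich hI hpts]
  exact comap_appTop_id I

/-- **TRANSPORT BACK ALONG `φ⁻¹` IS TRANSPORT ALONG ANY `χ : G' ⥲ G`**: for `I' ⊆ Γ(G')` the Frobenius-kernel ideal or étale, of corank `q`, and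
`#G(k) ∈ {1, q}`: `Γ(φ⁻¹)⁻¹ I' = Γ(χ)⁻¹ I'`. [cite: Tate1997FiniteFlatGroupSchemes, (3.7)] [cite: SGA3I, VII_A 4.1] -/
theorem comap_appTop_inv_eq_comap_appTop_of_dichotomy [IsAffine G.left] [IsFinite G.hom] (φ : G ≅ G') (χ : G' ≅ G) [IsMonHom φ.hom]
    [IsMonHom χ.hom]
    (I' : Ideal (Alg G'))
    (hdich : I' = (RingHom.ker (kerι (relFrobeniusOver p f G')).left.appTop.hom : Ideal (Alg G')) ∨
      Etale (Motives.specOver k (Alg G' ⧸ I')).hom)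
    (hI' : Module.finrank k (Alg G' ⧸ I') = p ^ f)
    (hpts : Nat.card (𝟙_ (SchemeOver k) ⟶ G) = 1 ∨ Nat.card (𝟙_ (SchemeOver k) ⟶ G) = p ^ f) :
    (I'.comap φ.inv.left.appTop.hom : Ideal (Alg G)) = I'.comap χ.hom.left.appTop.hom :=
  haveI : IsMonHom φ.symm.hom := inferInstanceAs (IsMonHom φ.inv)
  comap_appTop_eq_comap_appTop_of_dichotomy p f φ.symm χ I' hdich hI' hpts

/-! ## §4 Cocycle-freeness: transporting along a chain of isomorphisms depends only on the end points -/

/-- **COCYCLE-FREENESS: `Γ(χ)⁻¹ (Γ(φ)⁻¹ I) = Γ(ω)⁻¹ I`** for isomorphisms of group schemes `φ : G ⥲ G'`, `χ : G' ⥲ G''` and ANY `ω : G ⥲ G''`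
(`I` the Frobenius-kernel ideal or étale, of corank `q`; `#G''(k) ∈ {1, q}`): ★ functoriality `comap_appTop_comp` identifies the left side with the
transport along `φ ≪≫ χ`, and the HEAD compares `φ ≪≫ χ` with `ω`. [cite: Tate1997FiniteFlatGroupSchemes, (3.7)] [cite: SGA3I, VII_A 4.1] -/
theorem comap_appTop_comap_appTop_eq_of_dichotomy [IsAffine G''.left] [IsFinite G''.hom] (φ : G ≅ G') (χ : G' ≅ G'') (ω : G ≅ G'')
    [IsMonHom φ.hom] [IsMonHom χ.hom] [IsMonHom ω.hom] (I : Ideal (Alg G))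
    (hdich : I = (RingHom.ker (kerι (relFrobeniusOver p f G)).left.appTop.hom : Ideal (Alg G)) ∨
      Etale (Motives.specOver k (Alg G ⧸ I)).hom)
    (hI : Module.finrank k (Alg G ⧸ I) = p ^ f)
    (hpts'' : Nat.card (𝟙_ (SchemeOver k) ⟶ G'') = 1 ∨ Nat.card (𝟙_ (SchemeOver k) ⟶ G'') = p ^ f) :
    ((I.comap φ.hom.left.appTop.hom : Ideal (Alg G')).comap χ.hom.left.appTop.hom : Ideal (Alg G'')) = I.comap ω.hom.left.appTop.hom := by
  haveI : IsMonHom (φ ≪≫ χ).hom := inferInstanceAs (IsMonHom (φ.hom ≫ χ.hom))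
  rw [← comap_appTop_comp]
  exact comap_appTop_eq_comap_appTop_of_dichotomy p f (φ ≪≫ χ) ω I hdich hI hpts''

omit [GrpObj G''] in
/-- **ROUND TRIP: `Γ(χ)⁻¹ (Γ(φ)⁻¹ I) = I`** for isomorphisms of group schemes `φ : G ⥲ G'`, `χ : G' ⥲ G` (not necessarily inverse to each other;
`I` the Frobenius-kernel ideal or étale, of corank `q`; `#G(k) ∈ {1, q}`). [cite: Tate1997FiniteFlatGroupSchemes, (3.7)] [cite: SGA3I, VII_A 4.1] -/
theorem comap_appTop_comap_appTop_eq_self_of_dichotomy [IsAffine G.left] [IsFinite G.hom] (φ : G ≅ G') (χ : G' ≅ G) [IsMonHom φ.hom]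
    [IsMonHom χ.hom] (I : Ideal (Alg G))
    (hdich : I = (RingHom.ker (kerι (relFrobeniusOver p f G)).left.appTop.hom : Ideal (Alg G)) ∨
      Etale (Motives.specOver k (Alg G ⧸ I)).hom)
    (hI : Module.finrank k (Alg G ⧸ I) = p ^ f)
    (hpts : Nat.card (𝟙_ (SchemeOver k) ⟶ G) = 1 ∨ Nat.card (𝟙_ (SchemeOver k) ⟶ G) = p ^ f) :
    ((I.comap φ.hom.left.appTop.hom : Ideal (Alg G')).comap χ.hom.left.appTop.hom : Ideal (Alg G)) = I := by
  haveI : IsMonHom (φ ≪≫ χ).hom := inferInstanceAs (IsMonHom (φ.hom ≫ χ.hom))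
  rw [← comap_appTop_comp]
  exact comap_appTop_eq_self_of_dichotomy p f (φ ≪≫ χ) I hdich hI hpts

omit [IsAlgClosed k] [GrpObj G] [GrpObj G'] [GrpObj G''] in
/-- **THE ÉTALE KIND IS DETECTED AFTER TRANSPORT** (bookkeeping for the transport organ: «`smap H` is étale iff `H` is»).
[cite: Tate1997FiniteFlatGroupSchemes, (3.7)] -/
theorem etale_comap_appTop_iff (φ : G ≅ G') (I : Ideal (Alg G)) :
    Etale (Motives.specOver k (Alg G' ⧸ (I.comap φ.hom.left.appTop.hom : Ideal (Alg G')))).hom ↔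
      Etale (Motives.specOver k (Alg G ⧸ I)).hom :=
  etale_specOver_quotient_comap_appTop_iff φ I

end Transport

end Literature.AlgebraicGeometry.GroupSchemes.AdmIdealTransport

end
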